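import Summits.QuantumFields.YangMills.Theorems.SwapVirialDeficitBlowUpGnomonicTipCaps
import Summits.QuantumFields.YangMills.Theorems.SwapVirialDeficitSectorLaplaceTipGaussFloor
import HarnessLib

/-!
# The pointwise soft floor on the caps `R₁ ∪ R₂` (joint axis ≥ 30° from the hub axis) and the inverse axis permutation

Sub-problem `SwapVirialDeficit`, crux ⟨stmt-QuantumFields-24197⟩ `SwapGluedStiffness`, skeleton ➎, stub `stub_core_tip`, socket (hCore); LEAD g100's ruling (B6)
(STATUS 01:50Z): on the caps `R₁, R₂` the joint factor is taken POINTWISE, from a floor `F̂ ≥ c·s²·q̃` valid on the whole cap.  Here, from ✓`tip_four_floor`: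
* ★★ `tip_cap12_soft_floor` — for `1 ≤ δ` (so `δ²s² ≥ ½`, `s² = (1+δ²)⁻¹`) and `η ∈ R₁ ∪ R₂`:
  `s²·(|x|²+|y|²) / (2(1+|x|²+|y|²)) ≤ 7200·L⁶·F̂(hubAt δ 1, ε, η)` — the ROTATION-INVARIANT size `q̃ = (|x|²+|y|²)/(1+|x|²+|y|²)` (✓`normSq3_gnoRot`), so the
  floor reads the same in the transported (cap-0) letters;
* `tip_soft_pair_floor` — the cap-free intermediate `2s²(|x⊥|²/(1+|x|²) + |y⊥|²/(1+|y|²)) ≤ 7200L⁶F̂` (`1 ≤ δ`);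
* `rot3_star_capQuat` — for the `q` of ✓`exists_capQuat`, `rot3 q̄ v = (v₂, v₀, v₁)` (`= rot3 (q·q) v`), and `gnoRot_capQuat_star_gnoRot` — `gnoRot q (gnoRot q̄ η) = η`.

HONEST LABEL: helper inequalities only; (hCore), `stub_core_tip`, ⟨24197⟩, ⟨24194⟩ remain OPEN; nothing here proves the Yang–Mills mass gap.
-/

noncomputable section

open MeasureTheory Quaternion Set
open scoped Quaternion BigOperators ENNReal
open Literature.MathematicalPhysics.QuantumLattice
open Literature.MathematicalPhysics.QuantumFieldTheory hiding SU2

namespace Summit.QuantumFields.YangMills.Theorems.SwapVirialDeficit.BlowUpRing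

open Summit.QuantumFields.YangMills.Theorems.FemtoTransferGap
open Summit.QuantumFields.YangMills.Theorems.FemtoTransferGap.TT
open Summit.QuantumFields.YangMills.Theorems.VirialFluxGap.RingDeficit
open Summit.QuantumFields.YangMills.Theorems.SwapVirialDeficit.SwapRing
open Summit.QuantumFields.YangMills.Theorems.SwapVirialDeficit.Gnomonic (normSq3)

variable {L : ℕ} [NeZero L]

/-- ★ **THE SOFT PAIR FLOOR** (every letter, `1 ≤ δ`): `2s²·(|x⊥|²/(1+|x|²) + |y⊥|²/(1+|y|²)) ≤ 7200L⁶F̂(hubAt δ 1, ε, η)`. [cite: Luscher1983, §2] -/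
theorem tip_soft_pair_floor {δ : ℝ} (hδ : 1 ≤ δ) (ε : GnoSign L) (η : GnoCoord L) :
    2 * (1 + δ ^ 2)⁻¹ * (((η.1.1 1) ^ 2 + (η.1.1 2) ^ 2) / (1 + normSq3 η.1.1) + ((η.1.2 1) ^ 2 + (η.1.2 2) ^ 2) / (1 + normSq3 η.1.2)) ≤
      7200 * (L : ℝ) ^ 6 * gnoDeficit (fun _ => false) (fun _ => 1) (hubAt δ 1) ε η := by
  have h := tip_four_floor (L := L) δ ε η
  rw [← normSq3_eq_three', ← normSq3_eq_three', ← normSq3_eq_three'] at h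
  set s2 : ℝ := (1 + δ ^ 2)⁻¹ with hs2
  set U : ℝ := (η.1.1 1) ^ 2 + (η.1.1 2) ^ 2 with hU
  set Q : ℝ := (η.1.2 1) ^ 2 + (η.1.2 2) ^ 2 with hQ
  have hSx : 0 < 1 + normSq3 η.1.1 := by rw [normSq3_eq_three']; positivity
  have hSy : 0 < 1 + normSq3 η.1.2 := by rw [normSq3_eq_three']; positivity
  have hU0 : 0 ≤ U := by positivity
  have hQ0 : 0 ≤ Q := by positivity
  have hs0 : 0 < s2 := by positivity
  have hds : 1 / 2 ≤ δ ^ 2 * s2 := by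
    rw [hs2, ← div_eq_mul_inv, le_div_iff₀ (by positivity)]; nlinarith
  -- drop the stiff terms, compare `4δ²s⁴ ≥ 2s²`
  have hA : 0 ≤ 4 * ((η.1.1 2 * η.1.2 0 - η.1.1 0 * η.1.2 2) ^ 2 + (η.1.1 0 * η.1.2 1 - η.1.1 1 * η.1.2 0) ^ 2) /
      ((1 + normSq3 η.1.1) * (1 + normSq3 η.1.2)) := by positivity
  have hZ : 0 ≤ normSq3 η.2.1 / (1 + normSq3 η.2.1) := by
    have : 0 ≤ normSq3 η.2.1 := by rw [normSq3_eq_three']; positivity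
    positivity
  have h1 : 4 * δ ^ 2 * s2 ^ 2 * U / (1 + normSq3 η.1.1) ≥ 2 * s2 * (U / (1 + normSq3 η.1.1)) := by
    rw [mul_div_assoc]
    have hUd : 0 ≤ U / (1 + normSq3 η.1.1) := by positivity
    nlinarith [mul_nonneg hs0.le hUd]
  have h2 : 4 * s2 * Q / (1 + normSq3 η.1.2) = 2 * s2 * (2 * (Q / (1 + normSq3 η.1.2))) := by ring
  have hQd : 0 ≤ Q / (1 + normSq3 η.1.2) := by positivity
  nlinarith [h, h1, h2, hA, hZ, mul_nonneg hs0.le hQd]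

/-- ★★ **THE POINTWISE SOFT FLOOR ON THE CAPS `R₁ ∪ R₂`** (`1 ≤ δ`): if `x₀² + x_k² + y₀² + y_k² ≤ 3(x_i² + y_i²)` for `{i,k} = {1,2}`, then
`s²(|x|²+|y|²)/(2(1+|x|²+|y|²)) ≤ 7200·L⁶·F̂(hubAt δ 1, ε, η)` — rotation-invariant left-hand side. [cite: Luscher1983, §2] -/
theorem tip_cap12_soft_floor {δ : ℝ} (hδ : 1 ≤ δ) (ε : GnoSign L) (η : GnoCoord L)
    (hcap : (η.1.1 0) ^ 2 + (η.1.1 2) ^ 2 + (η.1.2 0) ^ 2 + (η.1.2 2) ^ 2 ≤ 3 * ((η.1.1 1) ^ 2 + (η.1.2 1) ^ 2) ∨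
      (η.1.1 0) ^ 2 + (η.1.1 1) ^ 2 + (η.1.2 0) ^ 2 + (η.1.2 1) ^ 2 ≤ 3 * ((η.1.1 2) ^ 2 + (η.1.2 2) ^ 2)) :
    (1 + δ ^ 2)⁻¹ * (normSq3 η.1.1 + normSq3 η.1.2) / (2 * (1 + normSq3 η.1.1 + normSq3 η.1.2)) ≤
      7200 * (L : ℝ) ^ 6 * gnoDeficit (fun _ => false) (fun _ => 1) (hubAt δ 1) ε η := by
  have h := tip_soft_pair_floor (L := L) hδ ε η
  rw [normSq3_eq_three', normSq3_eq_three'] at h ⊢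
  set s2 : ℝ := (1 + δ ^ 2)⁻¹ with hs2
  have hs0 : 0 < s2 := by positivity
  set x0 := η.1.1 0
  set x1 := η.1.1 1
  set x2 := η.1.1 2
  set y0 := η.1.2 0
  set y1 := η.1.2 1
  set y2 := η.1.2 2
  set G := 7200 * (L : ℝ) ^ 6 * gnoDeficit (fun _ => false) (fun _ => 1) (hubAt δ 1) ε η
  have hSx : 0 < 1 + (x0 ^ 2 + x1 ^ 2 + x2 ^ 2) := by positivity
  have hSy : 0 < 1 + (y0 ^ 2 + y1 ^ 2 + y2 ^ 2) := by positivity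
  have hS : 0 < 2 * (1 + (x0 ^ 2 + x1 ^ 2 + x2 ^ 2) + (y0 ^ 2 + y1 ^ 2 + y2 ^ 2)) := by positivity
  -- `U/(1+Sx) + Q/(1+Sy) ≥ (U+Q)/(1+Sx+Sy)`
  have hUQ : (x1 ^ 2 + x2 ^ 2 + (y1 ^ 2 + y2 ^ 2)) / (1 + (x0 ^ 2 + x1 ^ 2 + x2 ^ 2) + (y0 ^ 2 + y1 ^ 2 + y2 ^ 2)) ≤
      (x1 ^ 2 + x2 ^ 2) / (1 + (x0 ^ 2 + x1 ^ 2 + x2 ^ 2)) + (y1 ^ 2 + y2 ^ 2) / (1 + (y0 ^ 2 + y1 ^ 2 + y2 ^ 2)) := by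
    rw [add_div]
    refine add_le_add ?_ ?_
    · exact div_le_div_of_nonneg_left (by positivity) hSx (by nlinarith [sq_nonneg y0, sq_nonneg y1, sq_nonneg y2])
    · exact div_le_div_of_nonneg_left (by positivity) hSy (by nlinarith [sq_nonneg x0, sq_nonneg x1, sq_nonneg x2])
  -- cap: `Sx + Sy ≤ 4(U+Q)`
  have hcap' : x0 ^ 2 + x1 ^ 2 + x2 ^ 2 + (y0 ^ 2 + y1 ^ 2 + y2 ^ 2) ≤ 4 * (x1 ^ 2 + x2 ^ 2 + (y1 ^ 2 + y2 ^ 2)) := by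
    rcases hcap with hc | hc <;> nlinarith [sq_nonneg x1, sq_nonneg x2, sq_nonneg y1, sq_nonneg y2]
  have hstep : s2 * (x0 ^ 2 + x1 ^ 2 + x2 ^ 2 + (y0 ^ 2 + y1 ^ 2 + y2 ^ 2)) / (2 * (1 + (x0 ^ 2 + x1 ^ 2 + x2 ^ 2) + (y0 ^ 2 + y1 ^ 2 + y2 ^ 2))) ≤
      2 * s2 * ((x1 ^ 2 + x2 ^ 2 + (y1 ^ 2 + y2 ^ 2)) / (1 + (x0 ^ 2 + x1 ^ 2 + x2 ^ 2) + (y0 ^ 2 + y1 ^ 2 + y2 ^ 2))) := by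
    rw [div_le_iff₀ hS]
    have hS' : 0 < 1 + (x0 ^ 2 + x1 ^ 2 + x2 ^ 2) + (y0 ^ 2 + y1 ^ 2 + y2 ^ 2) := by positivity
    rw [show 2 * s2 * ((x1 ^ 2 + x2 ^ 2 + (y1 ^ 2 + y2 ^ 2)) / (1 + (x0 ^ 2 + x1 ^ 2 + x2 ^ 2) + (y0 ^ 2 + y1 ^ 2 + y2 ^ 2))) *
        (2 * (1 + (x0 ^ 2 + x1 ^ 2 + x2 ^ 2) + (y0 ^ 2 + y1 ^ 2 + y2 ^ 2))) = 4 * s2 * (x1 ^ 2 + x2 ^ 2 + (y1 ^ 2 + y2 ^ 2)) by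
      field_simp; ring]
    nlinarith [hcap', hs0.le]
  calc s2 * (x0 ^ 2 + x1 ^ 2 + x2 ^ 2 + (y0 ^ 2 + y1 ^ 2 + y2 ^ 2)) / (2 * (1 + (x0 ^ 2 + x1 ^ 2 + x2 ^ 2) + (y0 ^ 2 + y1 ^ 2 + y2 ^ 2)))
      ≤ 2 * s2 * ((x1 ^ 2 + x2 ^ 2 + (y1 ^ 2 + y2 ^ 2)) / (1 + (x0 ^ 2 + x1 ^ 2 + x2 ^ 2) + (y0 ^ 2 + y1 ^ 2 + y2 ^ 2))) := hstep
    _ ≤ 2 * s2 * ((x1 ^ 2 + x2 ^ 2) / (1 + (x0 ^ 2 + x1 ^ 2 + x2 ^ 2)) + (y1 ^ 2 + y2 ^ 2) / (1 + (y0 ^ 2 + y1 ^ 2 + y2 ^ 2))) :=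
        mul_le_mul_of_nonneg_left hUQ (by positivity)
    _ ≤ G := h

omit [NeZero L] in
/-- For the axis quaternion `q` of ✓`exists_capQuat`: `gnoRot q (gnoRot q̄ η) = η`, so `gnoRot q̄` maps `R₀` back onto `R₁` etc. [folklore] -/
theorem gnoRot_capQuat_star_gnoRot {q : ℍ} (hq : ‖q‖ = 1) (η : GnoCoord L) : gnoRot q (gnoRot (star q) η) = η := by
  have hsq : ‖star q‖ = 1 := by rw [Quaternion.norm_star]; exact hq
  have h := gnoRot_star_gnoRot (L := L) hsq η
  rwa [star_star] at h

omit [NeZero L] in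
/-- `rot3 q̄ v = (v₂, v₀, v₁)` — the inverse axis permutation (`= rot3 (q·q)`). [folklore] -/
theorem rot3_star_capQuat {q : ℍ} (hq : ‖q‖ = 1) (hrot : ∀ v : Fin 3 → ℝ, rot3 q v = ![v 1, v 2, v 0]) (v : Fin 3 → ℝ) :
    rot3 (star q) v = ![v 2, v 0, v 1] := by
  have hsq : ‖star q‖ = 1 := by rw [Quaternion.norm_star]; exact hq
  -- `rot3 q (rot3 q̄ v) = v` and `rot3 q w = (w₁, w₂, w₀)` determine `w = rot3 q̄ v`
  have hback : rot3 q (rot3 (star q) v) = v := by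
    rw [rot3_rot3 hq hsq, show star q * q = 1 from ?_, rot3_one]
    have h := Quaternion.star_mul_self q
    rw [Quaternion.normSq_eq_norm_mul_self, hq, mul_one, Quaternion.coe_one] at h
    exact h
  set w := rot3 (star q) v with hw
  have e := hrot w
  rw [hback] at e
  -- `v = (w 1, w 2, w 0)`
  have e0 : v 0 = w 1 := by have := congrFun e 0; simpa using this
  have e1 : v 1 = w 2 := by have := congrFun e 1; simpa using this
  have e2 : v 2 = w 0 := by have := congrFun e 2; simpa using this
  ext i
  fin_cases i <;> simp [e0, e1, e2]

end Summit.QuantumFields.YangMills.Theorems.SwapVirialDeficit.BlowUpRing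

end
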